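import Literature.Barriers.QuantumAdvantage.AaronsonChenPH
import Literature.Computability.Complexity.RandomOraclePHSipserProofs
import Literature.Computability.Complexity.KannanLanguage
import HarnessLib

/-!
# The diagonal languages `Sipser_d ∘ OR` of an oracle are in `PH^B` (discharge of `sipserOrLang_mem_PHRel`)

Sibling proof file (D-0014: theorems and concrete definitions only) of `AaronsonChenPH.lean`,
discharging its named fact

* `sipserOrLang_mem_PHRel_holds : sipserOrLang_mem_PHRel` — for every depth `d` and every
  oracle language `B`, `sipserOrLang d B ∈ PH^B`,

the routine upper-bound half of the `PH`–`AC⁰` connection in the proof of the second part of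
Aaronson–Chen 2017, Thm. 5.1 (§5.4, p. 24: "it is easy to see that [`Sipser_d ∘ OR`] has a
polynomial-size circuit (in fact, a formula) of depth `d + 1`"; Ko 1989, §4.2: "Then, clearly,
`L_A ∈ Σₖ^P(A)`"), by REUSING the assembly of the same statement for the plain Sipser languages
`sipserLang d A` (`RandomOraclePHSipserProofs.lean`, namespace `SipserPH`: state records `st`,
`startF`, `stepF`, the range test `V`, well-formed inputs `WF`): `sipserOrLang d B` differs from
`sipserLang d A` only in its LEAVES — leaf number `n` is not the oracle bit at the address
`x · natBits |x| n` but the hidden bit `blockOr B |x| n = ∃ e ∈ {0,1}^{|x|}, 1 · natBits |x| n · e ∈ B`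
of Aaronson–Chen's block, one more polynomially bounded existential quantifier over one oracle
query. So:

* `addrOrF ⟨record, e⟩ = 1 · takeD |x| S 0 · e` (the query; `∈ FP`), `E = {⟨record, e⟩ | |e| = |x|}`
  (`∈ P`), and the matrix `L0or B = ∃ᵉ (E ∩ addrOrF ⁻¹' B) ∈ PH^B` with
  `mem_L0or_iff : st x rest S W ∈ L0or B ↔ blockOr B |x| ⟦S⟧` (for a numeral `S`; `takeD_encodeNat`);
* `quantLangOr B r b` — the quantifier languages of `SipserPH` over this matrix, in `PH^B`
  (`quantLangOr_mem_PHRel`), with the semantics `mem_quantLangOr_iff` (the induction of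
  `SipserPH.mem_quantLang_iff` verbatim, for an arbitrary leaf-bit function);
* `sipserOrLang_eq : sipserOrLang d B = WF d ∩ startF ⁻¹' quantLangOr B d (bodd d)` and the
  discharge.

## References

* [AaronsonChen2017] S. Aaronson, L. Chen, CCC 2017 (arXiv:1612.05903), §5.2 (p. 20: the blocks
  and `g(p)`), §5.4 (p. 24: proof of the second part of Thm. 5.1).
* [Ko1989] K.-I Ko, *Constructing oracles by lower bound techniques for circuits* (1989), §4.2
  (p. 15–16).
* L. J. Stockmeyer, *The polynomial-time hierarchy*, Theoret. Comput. Sci. 3 (1976), §3.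
-/

noncomputable section

namespace Literature.Barriers.QuantumAdvantage

open _root_.Computability Literature.Computability.Complexity Literature.Computability.Complexity.Classes
  Literature.Computability.QuantumComplexity Polynomial Literature.Computability.Complexity.Brick
  Literature.Computability.Complexity.SipserPH

namespace SipserOrPH

/-! ### The matrix: one bounded `∃` over one oracle query -/

/-- **The oracle query below a leaf**: on `⟨record, e⟩` with record `⟨x, ⟨rest, ⟨S, W⟩⟩⟩`, the string
`1 · takeD |x| S 0 · e` (block prefix = the padded offset numeral, then the guessed suffix `e`).
[cite: AaronsonChen2017, §5.2 (p. 20)] -/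
def addrOrF : List Bool → List Bool :=
  List.cons true ∘ fun u => ((fstF ∘ padTakeFn ∘ fanoutFn fstF (nthF 2)) ∘ fstF) u ++ sndF u

/-- Value of `addrOrF`. [folklore] -/
theorem addrOrF_apply (x rest S W e : List Bool) :
    addrOrF (boolPair (st x rest S W) e) = true :: (List.takeD x.length S false ++ e) := by
  simp [addrOrF, st]

/-- `addrOrF ∈ FP`. [folklore] -/
theorem addrOrF_mem_FP : addrOrF ∈ FP := by
  have h0 : (fstF ∘ padTakeFn ∘ fanoutFn fstF (nthF 2)) ∘ fstF ∈ FP :=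
    comp_mem_FP (comp_mem_FP fstF_mem_FP (comp_mem_FP padTakeFn_mem_FP (fanoutFn_mem_FP fstF_mem_FP (nthF_mem_FP 2))))
      fstF_mem_FP
  have h1 : (fun u => ((fstF ∘ padTakeFn ∘ fanoutFn fstF (nthF 2)) ∘ fstF) u ++ sndF u) ∈ FP := append_mem_FP h0 sndF_mem_FP
  exact comp_mem_FP (cons_mem_FP true) h1

/-- The length test of the guessed suffix: `|e| = |x|` (compared through `0^{|·|}`). [folklore] -/
def E : Language Bool :=
  {z | (Kannan.zerosFn ∘ sndF) z = (Kannan.zerosFn ∘ fstF ∘ fstF) z}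

/-- `E ∈ P`. [folklore] -/
theorem E_mem_P : E ∈ Classes.P :=
  setOf_apply_eq_apply_mem_P (comp_mem_FP Kannan.zerosFn_mem_FP sndF_mem_FP)
    (comp_mem_FP Kannan.zerosFn_mem_FP (comp_mem_FP fstF_mem_FP fstF_mem_FP))

/-- Membership in `E`. [folklore] -/
theorem mem_E_iff (x rest S W e : List Bool) : boolPair (st x rest S W) e ∈ E ↔ e.length = x.length := by
  show (Kannan.zerosFn ∘ sndF) (boolPair (st x rest S W) e) = (Kannan.zerosFn ∘ fstF ∘ fstF) (boolPair (st x rest S W) e) ↔ _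
  simp only [Function.comp_apply, sndF_boolPair, fstF_boolPair, st, Kannan.zerosFn_apply]
  exact ⟨fun h => by simpa using congrArg List.length h, fun h => by rw [h]⟩

/-- **The matrix**: the hidden bit of the block addressed by the offset — a bounded `∃` over the
suffix `e`, the length test and one oracle query. [cite: AaronsonChen2017, §5.2 (p. 20, g(p) = ⋁ O(x))] -/
def L0or (B : Language Bool) : Language Bool := bexStr X (E ⊓ addrOrF ⁻¹' B)

/-- `L0or B ∈ PH^B`. [cite: Stockmeyer1976, §3] -/
theorem L0or_mem_PHRel (B : Language Bool) : L0or B ∈ PHRel (Oracle.ofLanguage B) :=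
  bexStr_mem_PHRel (inter_P_mem_PHRel E_mem_P
    (preimage_mem_PHRel (PRel_subset_PHRel _ (self_mem_PRel_ofLanguage_holds B)) addrOrF_mem_FP)) X

/-- **Semantics of the matrix**: on a record with offset numeral `S`, `L0or B` holds iff the hidden
bit `blockOr B |x| S` of block `S` at level `|x|` is set. [cite: AaronsonChen2017, §5.2 (p. 20)] -/
theorem mem_L0or_iff (B : Language Bool) (x rest W : List Bool) (S : ℕ) :
    st x rest (encodeNat S) W ∈ L0or B ↔ blockOr B x.length S := by
  have memI : ∀ (L₁ L₂ : Language Bool) (z : List Bool), z ∈ L₁ ⊓ L₂ ↔ z ∈ L₁ ∧ z ∈ L₂ := fun _ _ _ => Iff.rfl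
  rw [L0or, mem_bexStr, blockOr]
  simp only [eval_X, memI, mem_E_iff, mem_preimage', addrOrF_apply, takeD_encodeNat]
  constructor
  · rintro ⟨e, -, he, hB⟩
    exact ⟨e, he, hB⟩
  · rintro ⟨e, he, hB⟩
    refine ⟨e, ?_, he, hB⟩
    rw [he, st, length_boolPair]
    omega

/-! ### The quantifier languages over the matrix -/

/-- **The quantifier languages** of `SipserPH` over the matrix `L0or B`: `r` alternating
polynomially bounded quantifiers (root `∀` iff `b`), each guess range-checked by `V` and folded
into the record by `stepF`. [cite: Ko1989, §4.2 (p. 15–16)] [cite: Stockmeyer1976, §3] -/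
def quantLangOr (B : Language Bool) : ℕ → Bool → Language Bool
  | 0, _ => L0or B
  | r + 1, false => bexStr X (V ⊓ stepF ⁻¹' quantLangOr B r true)
  | r + 1, true => ballStr X (Vᶜ ⊔ stepF ⁻¹' quantLangOr B r false)

/-- No quantifier: the matrix. [folklore] -/
theorem quantLangOr_zero (B : Language Bool) (b : Bool) : quantLangOr B 0 b = L0or B := by
  cases b <;> rfl

/-- An `∨` root. [folklore] -/
theorem quantLangOr_succ_false (B : Language Bool) (r : ℕ) :
    quantLangOr B (r + 1) false = bexStr X (V ⊓ stepF ⁻¹' quantLangOr B r true) := rfl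

/-- An `∧` root. [folklore] -/
theorem quantLangOr_succ_true (B : Language Bool) (r : ℕ) :
    quantLangOr B (r + 1) true = ballStr X (Vᶜ ⊔ stepF ⁻¹' quantLangOr B r false) := rfl

/-- **Every quantifier language is in `PH^B`.** [cite: Ko1989, §4.2 (p. 16)] [cite: Stockmeyer1976, §3] -/
theorem quantLangOr_mem_PHRel (B : Language Bool) :
    ∀ (r : ℕ) (b : Bool), quantLangOr B r b ∈ PHRel (Oracle.ofLanguage B)
  | 0, b => by
    cases b <;> exact L0or_mem_PHRel B
  | r + 1, false =>
    bexStr_mem_PHRel (inter_P_mem_PHRel V_mem_P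
      (preimage_mem_PHRel (quantLangOr_mem_PHRel B r true) stepF_mem_FP)) X
  | r + 1, true =>
    ballStr_mem_PHRel (union_P_mem_PHRel (compl_mem_P_iff.2 V_mem_P)
      (preimage_mem_PHRel (quantLangOr_mem_PHRel B r false) stepF_mem_FP)) X

/-- The hidden bit of block number `n` at level `|x|`, as a Boolean (classically decided, as in
`sipserOrLang`). [cite: AaronsonChen2017, §5.2 (p. 20)] -/
def leafOr (B : Language Bool) (x : List Bool) (n : ℕ) : Bool :=
  @decide (blockOr B x.length n) (Classical.dec _)

/-- Re-indexing the leaves below child `i`: offset `S + W i`, weight `W v`. [folklore] -/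
theorem leaf_fun_eq (f : ℕ → Bool) (v : ℕ) (vs : List ℕ) (S W : ℕ) (i : Fin v) :
    (fun a : Addr vs => f (S + W * addrIndex (v :: vs) (i, a))) =
      fun a => f ((S + W * i) + (W * v) * addrIndex vs a) := by
  funext a
  show f (S + W * ((i : ℕ) + v * addrIndex vs a)) = _
  congr 1
  ring

/-- **Semantics of the quantifier languages**: on the record of input `x`, remaining fan-ins `vs`,
offset `S` and weight `W`, `quantLangOr B |vs| b` holds iff the alternating formula with fan-ins `vs`
and root `∧` iff `b` is true on the hidden bits of the blocks `S + W · addrIndex vs a`.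
[cite: Ko1989, §4.2 (p. 15–16)] [cite: AaronsonChen2017, §5.4 (p. 24)] -/
theorem mem_quantLangOr_iff (B : Language Bool) (x : List Bool) : ∀ (vs : List ℕ) (b : Bool) (S W : ℕ),
    st x (listcode vs) (encodeNat S) (encodeNat W) ∈ quantLangOr B vs.length b ↔
      sipserEval vs b (fun a => leafOr B x (S + W * addrIndex vs a)) = true
  | [], b, S, W => by
    rw [List.length_nil, quantLangOr_zero, mem_L0or_iff, sipserEval_nil]
    simp only [addrIndex, mul_zero, add_zero, leafOr]
    exact (@decide_eq_true_iff _ (Classical.dec _)).symm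
  | v :: vs, false, S, W => by
    have ih := fun S' W' => mem_quantLangOr_iff B x vs true S' W'
    have memI : ∀ (L₁ L₂ : Language Bool) (z : List Bool), z ∈ L₁ ⊓ L₂ ↔ z ∈ L₁ ∧ z ∈ L₂ :=
      fun _ _ _ => Iff.rfl
    rw [List.length_cons, quantLangOr_succ_false]
    simp only [mem_bexStr, eval_X, memI, mem_preimage', mem_V_iff, listcode_cons, fstF_boolPair,
      sndF_boolPair, bitsToNat_encodeNat, stepF_apply, sipserEval_cons_false, ih]
    constructor
    · rintro ⟨y, -, hyV, hyQ⟩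
      refine ⟨⟨bitsToNat y, hyV⟩, ?_⟩
      rw [leaf_fun_eq]
      exact hyQ
    · rintro ⟨i, hi⟩
      refine ⟨encodeNat i, length_encodeNat_le_st x i.isLt vs _ _, ?_⟩
      rw [bitsToNat_encodeNat, ← leaf_fun_eq]
      exact ⟨i.isLt, hi⟩
  | v :: vs, true, S, W => by
    have ih := fun S' W' => mem_quantLangOr_iff B x vs false S' W'
    have memS : ∀ (L₁ L₂ : Language Bool) (z : List Bool), z ∈ L₁ ⊔ L₂ ↔ z ∈ L₁ ∨ z ∈ L₂ :=
      fun _ _ _ => Iff.rfl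
    rw [List.length_cons, quantLangOr_succ_true]
    simp only [mem_ballStr, eval_X, memS, mem_compl', mem_preimage', mem_V_iff, listcode_cons,
      fstF_boolPair, sndF_boolPair, bitsToNat_encodeNat, stepF_apply, sipserEval_cons_true, ih]
    constructor
    · intro h i
      have hy := h (encodeNat i) (length_encodeNat_le_st x i.isLt vs _ _)
      rw [bitsToNat_encodeNat, ← leaf_fun_eq] at hy
      exact hy.resolve_left fun h' => h' i.isLt
    · intro h y _
      by_cases hy : bitsToNat y < v
      · right
        rw [← leaf_fun_eq (leafOr B x) v vs S W ⟨bitsToNat y, hy⟩]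
        exact h ⟨bitsToNat y, hy⟩
      · exact Or.inl hy

/-! ### Assembly -/

/-- **`Sipser_d ∘ OR` as a `P`-guarded quantifier language**:
`sipserOrLang d B = WF d ∩ startF ⁻¹' quantLangOr B d (bodd d)`. [cite: AaronsonChen2017, §5.4 (p. 24)] [cite: Ko1989, §4.2 (p. 15–16)] -/
theorem sipserOrLang_eq (d : ℕ) (B : Language Bool) :
    sipserOrLang d B = WF d ⊓ startF ⁻¹' quantLangOr B d (Nat.bodd d) := by
  ext x
  have memI : x ∈ WF d ⊓ startF ⁻¹' quantLangOr B d (Nat.bodd d) ↔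
      x ∈ WF d ∧ startF x ∈ quantLangOr B d (Nat.bodd d) := Iff.rfl
  rw [memI, mem_WF_iff, startF_apply]
  have h2 : ∀ ws : List ℕ, (boolUnpair x).1 = encodingListNatBool.encode ws →
      sndF (fstF x) = listcode ws := fun ws hcode => by
    rw [show fstF x = (boolUnpair x).1 from rfl, hcode, encode_eq, sndF_boolPair]
  have hfun : ∀ ws : List ℕ, (fun a : Addr ws => leafOr B x (0 + 1 * addrIndex ws a)) =
      fun a => @decide (blockOr B x.length (addrIndex ws a)) (Classical.dec _) := fun ws => by
    funext a
    rw [zero_add, one_mul, leafOr]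
  constructor
  · rintro ⟨ws, hlen, hcode, hprod, hval⟩
    refine ⟨⟨ws, hlen, hcode, hprod⟩, ?_⟩
    subst hlen
    rw [h2 ws hcode, mem_quantLangOr_iff, hfun]
    exact hval
  · rintro ⟨⟨ws, hlen, hcode, hprod⟩, hq⟩
    subst hlen
    rw [h2 ws hcode, mem_quantLangOr_iff, hfun] at hq
    exact ⟨ws, rfl, hcode, hprod, hq⟩

end SipserOrPH

/-- **Discharge of `sipserOrLang_mem_PHRel`: the diagonal languages `Sipser_d ∘ OR` are in `PH^B`.**
For every `d` and every oracle language `B`, `sipserOrLang d B ∈ PH^B`: a `P` test of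
well-formedness, then `d` alternating polynomially bounded quantifiers over child indices folded
into an offset/weight record, over one more bounded `∃` and one oracle query ("a formula of depth
`d + 1`"). [cite: AaronsonChen2017, §5.4 (p. 24, proof of the second part of Thm. 5.1)] [cite: Ko1989, §4.2 (p. 15–16)] -/
theorem sipserOrLang_mem_PHRel_holds : sipserOrLang_mem_PHRel := by
  intro d B
  rw [SipserOrPH.sipserOrLang_eq]
  exact inter_P_mem_PHRel (SipserPH.WF_mem_P d)
    (preimage_mem_PHRel (SipserOrPH.quantLangOr_mem_PHRel B d _) SipserPH.startF_mem_FP)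

end Literature.Barriers.QuantumAdvantage

end
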